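import Mathlib
import Summits.ResolutionOfSingularities.ResolutionOfSingularities.Theorems.RadicialJungCleanModelsCleanPrincipalizationOfProp44
import HarnessLib

/-!
# Route `RadicialJung`, crux `CleanModels` (stmt-ResolutionOfSingularities-15917), line `Sketch` rev 18, stub 4e
# `stub_cleanPrincipalization3`: composition of clean-permissible sequences

API for the future prover of the research residue X44c of 4e (memo `Cruxes/CleanModels/Lines/Sketch-memo-4e-cleanPermissible.md`): clean-permissible
sequences for an idealistic exponent (`IsCleanPermissibleSeq`, ✓ p684619) COMPOSE — a clean-permissible sequence for `(J, μ)` down to the weak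
transform `J₁` on `X₁`, followed by a clean-permissible sequence for `(J₁, μ)` on `X₁` (for the transform `π₁^♯ G` of the line), is a
clean-permissible sequence for `(J, μ)` (the W4.6 `IsPermissibleBlowupSeq.comp` pattern, used when a reach-tidy phase is followed by slices).

* `IsCleanPermissibleSeq.of_eq` (transport along an equality of morphisms), `IsCleanPermissibleSeq.comp`.

Honest framing: OURS, plumbing; nothing here proves resolution in characteristic `p` or any case of `CleanModels`.
-/

noncomputable section

set_option linter.dupNamespace false -- mandated namespace of this single-conjunct summit

open IsLocalRing CategoryTheory AlgebraicGeometry TopologicalSpace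
open Literature.AlgebraicGeometry.Resolution Literature.AlgebraicGeometry.Motives
open Scheme.IdealSheafData

namespace Summit.ResolutionOfSingularities.ResolutionOfSingularities.Theorems.RadicialJung.CleanModels

namespace IsCleanPermissibleSeq

/-- Transport of `IsCleanPermissibleSeq` along an equality of the structure morphism (the dominance instances are propositions). [folklore] -/
theorem of_eq {p : ℕ} {X' X : Scheme.{0}} [IsIntegral X'] [IsIntegral X] {π π' : X' ⟶ X} [IsDominant π] [IsDominant π'] (e : π = π')
    {J : X.IdealSheafData} {μ : ℕ} {J' : X'.IdealSheafData} {G : X.functionField} (h : IsCleanPermissibleSeq p π J μ J' G) :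
    IsCleanPermissibleSeq p π' J μ J' G := by
  subst e
  exact h

/-- **Clean-permissible sequences compose.**  If `π₁ : X₁ → X` is clean-permissible for `(J, μ)`, `G` with weak transform `J₁`, and
`π₂ : X₂ → X₁` is clean-permissible for `(J₁, μ)`, `π₁^♯ G` with weak transform `J₂`, then `π₂ ≫ π₁` is clean-permissible for `(J, μ)`, `G`
with weak transform `J₂` (induction on the second sequence; `(τ ≫ π₂) ≫ π₁ = τ ≫ (π₂ ≫ π₁)` and `(π₂ ≫ π₁)^♯ = π₂^♯ ∘ π₁^♯`). [folklore] -/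
theorem comp {p : ℕ} {X₁ X : Scheme.{0}} [IsIntegral X₁] [IsIntegral X] {π₁ : X₁ ⟶ X} [IsDominant π₁] {J : X.IdealSheafData}
    {μ : ℕ} {J₁ : X₁.IdealSheafData} {G : X.functionField} (h₁ : IsCleanPermissibleSeq p π₁ J μ J₁ G) :
    ∀ {X₂ : Scheme.{0}} [IsIntegral X₂] {π₂ : X₂ ⟶ X₁} [IsDominant π₂] {J₂ : X₂.IdealSheafData} {G₁ : X₁.functionField},
      IsCleanPermissibleSeq p π₂ J₁ μ J₂ G₁ → G₁ = RatFn.functionFieldMap π₁ G →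
      IsCleanPermissibleSeq p (π₂ ≫ π₁) J μ J₂ G := by
  intro X₂ _ π₂ _ J₂ G₁ h₂
  induction h₂ with
  | nil J₁ μ G₁ =>
    intro _
    exact of_eq (Category.id_comp π₁).symm h₁
  | @cons X'' X' X₁ _ _ _ τ _ π₂ _ J₁ μ J' G₁ Y hπ₂ hint hreg hY hτ hperm ih =>
    intro hG
    have key := IsCleanPermissibleSeq.cons τ (π₂ ≫ π₁) J μ J' G Y (ih h₁ hG) hint hreg hY hτ (fun y hy => by
      rw [RatFn.functionFieldMap_comp, RingHom.comp_apply, ← hG]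
      exact hperm y hy)
    exact of_eq (Category.assoc τ π₂ π₁) key

end IsCleanPermissibleSeq

end Summit.ResolutionOfSingularities.ResolutionOfSingularities.Theorems.RadicialJung.CleanModels

end
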